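import Mathlib.Analysis.SpecialFunctions.Pow.Real
import Mathlib.Analysis.Real.Pi.Bounds
import HarnessLib

/-!
# Numerics of the per-unit sampling law of a shift-cell / coset table

Topic `Computability/Cryptography`; theorem-only file, no named facts. The explicit parameter thresholds of the sampling
law of the class-group stage of `LinnikCubicClassGroups.PureCubicClassGroupFBQP` (window `u ≥ 2^(e₆+8) hB (T+1)`, digit
size `2^ℓe ≥ hB³(2u)^T 2^(s+e₆+40)`, grid `2^s ≥ Ncell·hB·2^(2e₆+16)`, slice window `K₀ 2^(e₆+8) hB ≤ 2^s ≤ 2K₀ 2^(e₆+8) hB`)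
imply the real inequalities consumed by the window laws (`PeriodFindingClassBallLaw`, `PeriodFindingShiftCellLaw`):

* `samplingLaw_side` — `3 ≤ u`, `u/M ≤ 1/(4hB)`, `1 ≤ K₀`;
* `samplingLaw_small_terms` — `hB³T/M ≤ 2^-(e₆+40)`, `T/(u−2) ≤ 2^-(e₆+8)/hB`, `2hB³(2u)^T/M ≤ 2^-(e₆+39)`,
  `2πK₀/S ≤ 2π·2^-(e₆+8)/hB`, `2Ncell/K₀ ≤ 2^-(e₆+6)`;
* `samplingLaw_ball_numerics` — `8hB³T/M + 8hB(T/(u−2) + 2hB²(2u)^T/M) + 16hB(1 + hB²T/M)·2πK₀/S ≤ 1`;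
* `samplingLaw_inaccurate_numerics` — `2Ncell/K₀ + hB²T/M + (T/(u−2) + 2hB²(2u)^T/M) + 2(1 + hB²T/M)·2πK₀/S ≤ 2^-e₆`;
* `samplingLaw_tv_numerics` — `2√(2ε) ≤ 2^-e₆` for `ε ≤ 2^-(2e₆+8)`.
-/

namespace Literature.Computability.Cryptography

namespace PeriodFinding

/-- **Side conditions**: `3 ≤ u`, `u/2^ℓe ≤ 1/(4hB)` and `1 ≤ K₀`. [folklore] -/
theorem samplingLaw_side {T ℓe s hB u e₆ K₀ : ℕ} (hT : 1 ≤ T) (h1 : 1 ≤ hB)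
    (hu : 2 ^ (e₆ + 8) * hB * (T + 1) ≤ u) (hM : hB ^ 3 * (2 * u) ^ T * 2 ^ (s + e₆ + 40) ≤ 2 ^ ℓe)
    (hK : 2 ^ s ≤ 2 * K₀ * (2 ^ (e₆ + 8) * hB)) :
    3 ≤ u ∧ (u : ℝ) / ((2 ^ ℓe : ℕ) : ℝ) ≤ 1 / (4 * hB) ∧ 1 ≤ K₀ := by
  have hu3 : 3 ≤ u := by
    have : 2 ^ (e₆ + 8) * hB * (T + 1) ≥ 2 ^ 8 * 1 * 2 := by
      apply Nat.mul_le_mul (Nat.mul_le_mul (Nat.pow_le_pow_right (by norm_num) (by omega)) h1); omega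
    omega
  refine ⟨hu3, ?_, ?_⟩
  · -- `4 hB u ≤ hB³ (2u)^T 2^(s+e₆+40) ≤ 2^ℓe`
    have hnat : 4 * hB * u ≤ 2 ^ ℓe := by
      refine le_trans ?_ hM
      have h2u : 2 * u ≤ (2 * u) ^ T := by
        calc 2 * u = (2 * u) ^ 1 := (pow_one _).symm
          _ ≤ (2 * u) ^ T := Nat.pow_le_pow_right (by omega) hT
      have hB3 : hB ≤ hB ^ 3 := by
        calc hB = hB ^ 1 := (pow_one _).symm
          _ ≤ hB ^ 3 := Nat.pow_le_pow_right h1 (by norm_num)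
      have h40 : 2 ≤ 2 ^ (s + e₆ + 40) := by
        calc 2 = 2 ^ 1 := rfl
          _ ≤ 2 ^ (s + e₆ + 40) := Nat.pow_le_pow_right (by norm_num) (by omega)
      calc 4 * hB * u = hB * (2 * u) * 2 := by ring
        _ ≤ hB ^ 3 * (2 * u) ^ T * 2 ^ (s + e₆ + 40) :=
          Nat.mul_le_mul (Nat.mul_le_mul hB3 h2u) h40
    have hMR : (0 : ℝ) < ((2 ^ ℓe : ℕ) : ℝ) := by positivity
    have hBR : (0 : ℝ) < hB := by exact_mod_cast h1
    rw [div_le_div_iff₀ hMR (by positivity)]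
    have : (4 : ℝ) * hB * u ≤ ((2 ^ ℓe : ℕ) : ℝ) := by exact_mod_cast hnat
    linarith
  · rcases Nat.eq_zero_or_pos K₀ with h0 | h0
    · subst h0; simp at hK
    · exact h0

/-- **The small terms.** [folklore] -/
theorem samplingLaw_small_terms {T ℓe s Ncell hB u e₆ K₀ : ℕ} (hT : 1 ≤ T) (h1 : 1 ≤ hB)
    (hu : 2 ^ (e₆ + 8) * hB * (T + 1) ≤ u) (hM : hB ^ 3 * (2 * u) ^ T * 2 ^ (s + e₆ + 40) ≤ 2 ^ ℓe)
    (hN : Ncell * hB * 2 ^ (2 * e₆ + 16) ≤ 2 ^ s)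
    (hKlo : K₀ * (2 ^ (e₆ + 8) * hB) ≤ 2 ^ s) (hKhi : 2 ^ s ≤ 2 * K₀ * (2 ^ (e₆ + 8) * hB)) :
    (hB : ℝ) * ((hB : ℝ) ^ 2 * T / ((2 ^ ℓe : ℕ) : ℝ)) ≤ (1 / 2) ^ (e₆ + 40) ∧
    (T : ℝ) / (u - 2) ≤ (1 / 2) ^ (e₆ + 8) / hB ∧
    (hB : ℝ) * (2 * (hB : ℝ) ^ 2 * (2 * u) ^ T / ((2 ^ ℓe : ℕ) : ℝ)) ≤ (1 / 2) ^ (e₆ + 39) ∧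
    2 * Real.pi * K₀ / ((2 ^ s : ℕ) : ℝ) ≤ 2 * Real.pi * (1 / 2) ^ (e₆ + 8) / hB ∧
    2 * (Ncell : ℝ) / K₀ ≤ (1 / 2) ^ (e₆ + 6) := by
  obtain ⟨hu3, -, hK1⟩ := samplingLaw_side (s := s) hT h1 hu hM hKhi
  have hBR : (1 : ℝ) ≤ hB := by exact_mod_cast h1
  have hTR : (1 : ℝ) ≤ T := by exact_mod_cast hT
  have hKR : (1 : ℝ) ≤ K₀ := by exact_mod_cast hK1
  have hMR : (hB : ℝ) ^ 3 * (2 * u) ^ T * 2 ^ (s + e₆ + 40) ≤ ((2 ^ ℓe : ℕ) : ℝ) := by exact_mod_cast hM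
  have hMpos : (0 : ℝ) < ((2 ^ ℓe : ℕ) : ℝ) := by positivity
  have hSR : ((2 ^ s : ℕ) : ℝ) = (2 : ℝ) ^ s := by push_cast; ring
  have huR : (2 : ℝ) ^ (e₆ + 8) * hB * (T + 1) ≤ u := by exact_mod_cast hu
  have hNR : (Ncell : ℝ) * hB * 2 ^ (2 * e₆ + 16) ≤ (2 : ℝ) ^ s := by exact_mod_cast hN
  have hKloR : (K₀ : ℝ) * (2 ^ (e₆ + 8) * hB) ≤ (2 : ℝ) ^ s := by exact_mod_cast hKlo
  have hKhiR : (2 : ℝ) ^ s ≤ 2 * K₀ * (2 ^ (e₆ + 8) * hB) := by exact_mod_cast hKhi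
  have h2uT : (T : ℝ) ≤ (2 * u : ℝ) ^ T := by
    have h1' : (T : ℝ) ≤ 2 ^ T := by exact_mod_cast (Nat.lt_two_pow_self).le
    have h2' : (2 : ℝ) ^ T ≤ (2 * u : ℝ) ^ T := by
      apply pow_le_pow_left₀ (by norm_num)
      have : (3 : ℝ) ≤ u := by exact_mod_cast hu3
      linarith
    exact h1'.trans h2'
  have hhalf : ∀ n : ℕ, ((1 : ℝ) / 2) ^ n = 1 / 2 ^ n := fun n => by rw [one_div_pow]
  refine ⟨?_, ?_, ?_, ?_, ?_⟩
  · -- `hB³ T / M ≤ 2^-(e₆+40)`: `hB³ T 2^(e₆+40) ≤ hB³ (2u)^T 2^(s+e₆+40) ≤ M`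
    rw [← mul_div_assoc, div_le_iff₀ hMpos, hhalf, one_div_mul_eq_div, le_div_iff₀ (by positivity)]
    calc (hB : ℝ) * ((hB : ℝ) ^ 2 * T) * 2 ^ (e₆ + 40) = (hB : ℝ) ^ 3 * T * 2 ^ (e₆ + 40) := by ring
      _ ≤ (hB : ℝ) ^ 3 * (2 * u) ^ T * 2 ^ (s + e₆ + 40) := by
          have e2 : (2 : ℝ) ^ (e₆ + 40) ≤ 2 ^ (s + e₆ + 40) := pow_le_pow_right₀ (by norm_num) (by omega)
          gcongr
      _ ≤ _ := hMR
  · -- `T/(u−2) ≤ 2^-(e₆+8)/hB`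
    have hu2 : (0 : ℝ) < (u : ℝ) - 2 := by
      have : (3 : ℝ) ≤ u := by exact_mod_cast hu3
      linarith
    rw [div_le_div_iff₀ hu2 (by positivity), hhalf]
    have : (T : ℝ) * hB * 2 ^ (e₆ + 8) ≤ (u : ℝ) - 2 := by
      have h2 : (2 : ℝ) ≤ 2 ^ (e₆ + 8) * hB := by
        have : (2 : ℝ) ≤ 2 ^ (e₆ + 8) := by
          calc (2 : ℝ) = 2 ^ 1 := by norm_num
            _ ≤ 2 ^ (e₆ + 8) := pow_le_pow_right₀ (by norm_num) (by omega)
        nlinarith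
      nlinarith
    calc (T : ℝ) * hB = (T : ℝ) * hB * 2 ^ (e₆ + 8) * (1 / 2 ^ (e₆ + 8)) := by field_simp
      _ ≤ ((u : ℝ) - 2) * (1 / 2 ^ (e₆ + 8)) := by gcongr
      _ = 1 / 2 ^ (e₆ + 8) * (u - 2) := by ring
  · -- `2hB³(2u)^T/M ≤ 2^-(e₆+39)`
    rw [← mul_div_assoc, div_le_iff₀ hMpos, hhalf, one_div_mul_eq_div, le_div_iff₀ (by positivity)]
    calc (hB : ℝ) * (2 * (hB : ℝ) ^ 2 * (2 * u) ^ T) * 2 ^ (e₆ + 39) = (hB : ℝ) ^ 3 * (2 * u) ^ T * 2 ^ (e₆ + 40) := by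
          ring
      _ ≤ (hB : ℝ) ^ 3 * (2 * u) ^ T * 2 ^ (s + e₆ + 40) := by
          have e2 : (2 : ℝ) ^ (e₆ + 40) ≤ 2 ^ (s + e₆ + 40) := pow_le_pow_right₀ (by norm_num) (by omega)
          gcongr
      _ ≤ _ := hMR
  · -- `2πK₀/S ≤ 2π 2^-(e₆+8)/hB`
    have h : (K₀ : ℝ) / 2 ^ s ≤ (1 / 2) ^ (e₆ + 8) / hB := by
      rw [div_le_div_iff₀ (by positivity) (by positivity), hhalf]
      calc (K₀ : ℝ) * hB = (K₀ : ℝ) * (2 ^ (e₆ + 8) * hB) * (1 / 2 ^ (e₆ + 8)) := by field_simp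
        _ ≤ (2 : ℝ) ^ s * (1 / 2 ^ (e₆ + 8)) := by gcongr
        _ = 1 / 2 ^ (e₆ + 8) * 2 ^ s := by ring
    calc 2 * Real.pi * K₀ / ((2 ^ s : ℕ) : ℝ) = 2 * Real.pi * ((K₀ : ℝ) / 2 ^ s) := by rw [hSR]; ring
      _ ≤ 2 * Real.pi * ((1 / 2) ^ (e₆ + 8) / hB) := mul_le_mul_of_nonneg_left h (by positivity)
      _ = _ := by ring
  · -- `2Ncell/K₀ ≤ 2^-(e₆+6)`: `2 Ncell 2^(e₆+6) ≤ K₀` from `Ncell hB 2^(2e₆+16) ≤ S ≤ 2K₀ 2^(e₆+8) hB`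
    rw [div_le_iff₀ (by positivity), hhalf, one_div_mul_eq_div, le_div_iff₀ (by positivity)]
    have key : (Ncell : ℝ) * hB * 2 ^ (2 * e₆ + 16) ≤ 2 * K₀ * (2 ^ (e₆ + 8) * hB) := hNR.trans hKhiR
    have e : (2 : ℝ) ^ (2 * e₆ + 16) = 2 ^ (e₆ + 6) * 2 ^ (e₆ + 8) * 4 := by
      rw [← pow_add, show (4 : ℝ) = 2 ^ 2 by norm_num, ← pow_add]; congr 1; omega
    rw [e] at key
    have hBpos : (0 : ℝ) < hB := by linarith
    have key' : (2 * (Ncell : ℝ) * 2 ^ (e₆ + 6)) * (2 * 2 ^ (e₆ + 8) * hB) ≤ K₀ * (2 * 2 ^ (e₆ + 8) * hB) := by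
      calc (2 * (Ncell : ℝ) * 2 ^ (e₆ + 6)) * (2 * 2 ^ (e₆ + 8) * hB)
          = (Ncell : ℝ) * hB * (2 ^ (e₆ + 6) * 2 ^ (e₆ + 8) * 4) := by ring
        _ ≤ 2 * K₀ * (2 ^ (e₆ + 8) * hB) := key
        _ = K₀ * (2 * 2 ^ (e₆ + 8) * hB) := by ring
    exact le_of_mul_le_mul_right key' (by positivity)

/-- **Numerics of the ball law** (`shiftCell_ball_mass_le`):
`8hB³T/M + 8hB(T/(u−2) + 2hB²(2u)^T/M) + 16hB(1 + hB²T/M)·2πK₀/S ≤ 1`. [folklore] -/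
theorem samplingLaw_ball_numerics : ∀ {T ℓe s Ncell hB u e₆ K₀ : ℕ}, 1 ≤ T → 1 ≤ hB →
    2 ^ (e₆ + 8) * hB * (T + 1) ≤ u → hB ^ 3 * (2 * u) ^ T * 2 ^ (s + e₆ + 40) ≤ 2 ^ ℓe →
    Ncell * hB * 2 ^ (2 * e₆ + 16) ≤ 2 ^ s →
    K₀ * (2 ^ (e₆ + 8) * hB) ≤ 2 ^ s → 2 ^ s ≤ 2 * K₀ * (2 ^ (e₆ + 8) * hB) →
    8 * ((hB : ℝ) ^ 3 * T / ((2 ^ ℓe : ℕ) : ℝ)) +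
      8 * (hB * ((T : ℝ) / (u - 2) + 2 * (hB : ℝ) ^ 2 * (2 * u) ^ T / ((2 ^ ℓe : ℕ) : ℝ))) +
      16 * hB * (1 + (hB : ℝ) ^ 2 * T / ((2 ^ ℓe : ℕ) : ℝ)) * (2 * Real.pi * K₀ / ((2 ^ s : ℕ) : ℝ)) ≤ 1 := by
  intro T ℓe s Ncell hB u e₆ K₀ hT h1 hu hM hN hKlo hKhi
  obtain ⟨tA, tB, tC, tD, -⟩ := samplingLaw_small_terms hT h1 hu hM hN hKlo hKhi
  have hBR : (1 : ℝ) ≤ hB := by exact_mod_cast h1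
  have hBpos : (0 : ℝ) < hB := by linarith
  set X : ℝ := (1 / 2) ^ e₆ with hX
  have hX1 : X ≤ 1 := pow_le_one₀ (by norm_num) (by norm_num)
  have hX0 : 0 < X := by positivity
  have hhalf : ∀ n : ℕ, ((1 : ℝ) / 2) ^ (e₆ + n) = X / 2 ^ n := fun n => by
    rw [pow_add, hX, one_div_pow, one_div_pow]; field_simp
  rw [hhalf] at tA tB tC tD
  set A : ℝ := (hB : ℝ) ^ 2 * T / ((2 ^ ℓe : ℕ) : ℝ) with hA
  set B : ℝ := (T : ℝ) / (u - 2) with hB'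
  set Cc : ℝ := 2 * (hB : ℝ) ^ 2 * (2 * u) ^ T / ((2 ^ ℓe : ℕ) : ℝ) with hCc
  set D : ℝ := 2 * Real.pi * K₀ / ((2 ^ s : ℕ) : ℝ) with hD
  have hA0 : 0 ≤ A := by positivity
  have hD0 : 0 ≤ D := by positivity
  have tB' : (hB : ℝ) * B ≤ X / 2 ^ 8 := by
    calc (hB : ℝ) * B ≤ hB * (X / 2 ^ 8 / hB) := mul_le_mul_of_nonneg_left tB hBpos.le
      _ = X / 2 ^ 8 := by field_simp
  have tD' : (hB : ℝ) * D ≤ 2 * Real.pi * X / 2 ^ 8 := by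
    calc (hB : ℝ) * D ≤ hB * (2 * Real.pi * (X / 2 ^ 8) / hB) := mul_le_mul_of_nonneg_left tD hBpos.le
      _ = 2 * Real.pi * X / 2 ^ 8 := by field_simp
  have tA' : A ≤ X / 2 ^ 40 := (le_mul_of_one_le_left hA0 hBR).trans tA
  have e1 : 8 * ((hB : ℝ) ^ 3 * T / ((2 ^ ℓe : ℕ) : ℝ)) + 8 * (hB * (B + Cc)) + 16 * hB * (1 + A) * D =
      8 * (hB * A) + 8 * (hB * B) + 8 * (hB * Cc) + 16 * (hB * D) * (1 + A) := by rw [hA]; ring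
  rw [e1]
  have hpi := Real.pi_lt_d2
  have h16 : 16 * ((hB : ℝ) * D) * (1 + A) ≤ 16 * (2 * Real.pi * X / 2 ^ 8) * (1 + X / 2 ^ 40) := by
    gcongr
  nlinarith [h16, tA, tB', tC, hX1, hX0, Real.pi_pos]

/-- **Numerics of the inaccurate mass** (`shiftCell_tail_mass_le` + `shiftCell_offBall_mass_le`):
`2Ncell/K₀ + hB²T/M + (T/(u−2) + 2hB²(2u)^T/M) + 2(1 + hB²T/M)·2πK₀/S ≤ 2^-e₆`. [folklore] -/
theorem samplingLaw_inaccurate_numerics {T ℓe s Ncell hB u e₆ K₀ : ℕ} (hT : 1 ≤ T) (h1 : 1 ≤ hB)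
    (hu : 2 ^ (e₆ + 8) * hB * (T + 1) ≤ u) (hM : hB ^ 3 * (2 * u) ^ T * 2 ^ (s + e₆ + 40) ≤ 2 ^ ℓe)
    (hN : Ncell * hB * 2 ^ (2 * e₆ + 16) ≤ 2 ^ s)
    (hKlo : K₀ * (2 ^ (e₆ + 8) * hB) ≤ 2 ^ s) (hKhi : 2 ^ s ≤ 2 * K₀ * (2 ^ (e₆ + 8) * hB)) :
    2 * (Ncell : ℝ) / K₀ + ((hB : ℝ) ^ 2 * T / ((2 ^ ℓe : ℕ) : ℝ) +
      ((T : ℝ) / (u - 2) + 2 * (hB : ℝ) ^ 2 * (2 * u) ^ T / ((2 ^ ℓe : ℕ) : ℝ)) +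
      2 * (1 + (hB : ℝ) ^ 2 * T / ((2 ^ ℓe : ℕ) : ℝ)) * (2 * Real.pi * K₀ / ((2 ^ s : ℕ) : ℝ))) ≤ (1 / 2) ^ e₆ := by
  obtain ⟨tA, tB, tC, tD, tE⟩ := samplingLaw_small_terms hT h1 hu hM hN hKlo hKhi
  have hBR : (1 : ℝ) ≤ hB := by exact_mod_cast h1
  have hBpos : (0 : ℝ) < hB := by linarith
  set X : ℝ := (1 / 2) ^ e₆ with hX
  have hX1 : X ≤ 1 := pow_le_one₀ (by norm_num) (by norm_num)
  have hX0 : 0 < X := by positivity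
  have hhalf : ∀ n : ℕ, ((1 : ℝ) / 2) ^ (e₆ + n) = X / 2 ^ n := fun n => by
    rw [pow_add, hX, one_div_pow, one_div_pow]; field_simp
  rw [hhalf] at tA tB tC tD tE
  set A : ℝ := (hB : ℝ) ^ 2 * T / ((2 ^ ℓe : ℕ) : ℝ) with hA
  set B : ℝ := (T : ℝ) / (u - 2) with hB'
  set Cc : ℝ := 2 * (hB : ℝ) ^ 2 * (2 * u) ^ T / ((2 ^ ℓe : ℕ) : ℝ) with hCc
  set D : ℝ := 2 * Real.pi * K₀ / ((2 ^ s : ℕ) : ℝ) with hD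
  have hA0 : 0 ≤ A := by positivity
  have hC0 : 0 ≤ Cc := by positivity
  have hD0 : 0 ≤ D := by positivity
  have tA' : A ≤ X / 2 ^ 40 := (le_mul_of_one_le_left hA0 hBR).trans tA
  have tC' : Cc ≤ X / 2 ^ 39 := (le_mul_of_one_le_left hC0 hBR).trans tC
  have tB' : B ≤ X / 2 ^ 8 := tB.trans (div_le_self (by positivity) hBR)
  have tD' : D ≤ 2 * Real.pi * X / 2 ^ 8 := by
    refine tD.trans ?_
    rw [div_le_iff₀ hBpos]
    have : 0 ≤ 2 * Real.pi * X / 2 ^ 8 := by positivity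
    nlinarith
  have hpi := Real.pi_lt_d2
  have h2 : 2 * (1 + A) * D ≤ 2 * (1 + X / 2 ^ 40) * (2 * Real.pi * X / 2 ^ 8) := by gcongr
  nlinarith [h2, tA', tB', tC', tE, hX1, hX0, Real.pi_pos]

/-- **Numerics of the total variation**: `2√(2ε) ≤ 2^-e₆` for `ε ≤ 2^-(2e₆+8)`. [folklore] -/
theorem samplingLaw_tv_numerics {e₆ : ℕ} {ε : ℝ} (hε : ε ≤ (1 / 2) ^ (2 * e₆ + 8)) :
    2 * Real.sqrt (2 * ε) ≤ (1 / 2) ^ e₆ := by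
  have hX0 : (0 : ℝ) < (1 / 2) ^ e₆ := by positivity
  have hsq : Real.sqrt (2 * ε) ≤ (1 / 2) ^ e₆ / 4 := by
    rw [Real.sqrt_le_left (by positivity)]
    calc 2 * ε ≤ 2 * (1 / 2) ^ (2 * e₆ + 8) := by linarith
      _ = ((1 / 2) ^ e₆ / 4) ^ 2 * (2 / 16) := by rw [pow_add, mul_comm 2 e₆, pow_mul]; ring
      _ ≤ ((1 / 2) ^ e₆ / 4) ^ 2 := by nlinarith [sq_nonneg ((1 / 2 : ℝ) ^ e₆ / 4)]
  linarith

end PeriodFinding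

end Literature.Computability.Cryptography
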